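import Mathlib
import Summits.Ventures.HodgeRepro.OcticCMPointTruncThreePsi5
import Summits.Ventures.HodgeRepro.OcticCMPointDualSign

/-!
# OcticCMPointTruncThreeSign — the conductor-`3` root number at `𝔭 | 5` for EVERY primitive `ψ₀`, in closed form

Blind re-derivation cell `pub-hodge-repro`, seat night-2 (gen 4).  Target tree path
`lean/Summits/Ventures/HodgeRepro/OcticCMPointTruncThreeSign.lean`.  Closes the last sign left open at
`𝔭₁, 𝔭₂ | 5`: `OcticCMPointTruncThree.lean` gives `ε(½, ρ, ψ̃₀) = ρ(ϖ)^n · κ |k| · G(χ_quad, ψ₀(·/2))` for the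
explicit conductor-`3` twist, `OcticCMPointTruncThreePsi5.lean` evaluates it for the standard `ψ₅`
(`= −ρ(ϖ)^n`), and here the general case: every primitive `ψ₀` of `𝔽₅` is `ψ₅(a ·)` for a unique `a ≠ 0`
(`OcticCMPointDualSign.exists_mulShift_eq`), the Gauss sum scales by `χ_quad(a)` (Mathlib
`gaussSum_mulShift_eq`), and so

* `exists_eq_mulShift_psi5` — `ψ₀ = ψ₅(a ·)` with `a ≠ 0`;
* `gaussSum_quadChar_mulShift_half` — `G(χ_quad, ψ₀(·/2)) = −χ_quad(a) √5`;
* `eps_twist_three_mulShift`, `eps_twist_three_of_isPrimitive` — **`ε(½, ρ, ψ̃₀) = −χ_quad(a) ρ(ϖ)^n`** with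
  `κ = (5√5)⁻¹`: Gauss's sign times the Legendre symbol of the scaling.

With `OcticCMPointTruncFour.lean` (`+ρ(ϖ)^n` at conductor `4` for every `ψ₀`) the root numbers of the explicit
twists at `𝔭 | 5` are now closed-form for every primitive `ψ₀` at both conductors `3` and `4`; the same scaling
argument gives conductor `1` for every `ψ₀`: `ε(½, ⟨χ_quad, ω(ϖ)⟩, ψ₅(a ·)) = χ_quad(a) ω(ϖ)^n`
(`eps_quad_mulShift`, `eps_quad_of_isPrimitive`), the `±` of `OcticCMPointTameModel.eps_quad_tame` made explicit.

**What this is not.**  The four `χ′_j` of the octic face are on no page; `c ≥ 5` is not covered.  Nothing here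
says anything about the status of the Hodge conjecture for CM abelian varieties, which is NOT proved.
-/

set_option autoImplicit false

noncomputable section

namespace Summit.Ventures.HodgeRepro.PeriodCloser

open GaussSumStability

namespace TruncModel

/-! ### Every primitive `ψ₀` on `𝔽₅`: the conductor-`3` sign is Gauss's sign times the Legendre symbol -/

/-- **Every primitive additive character of `𝔽₅` is `ψ₅(a ·)` for some `a ≠ 0`** (`DualModel.exists_mulShift_eq`;
`a ≠ 0` because `ψ₅(0 ·) = 1` is not primitive; `a` is unique by `DualModel.mulShift_injective`). -/
theorem exists_eq_mulShift_psi5 (ψ₀ : AddChar (ZMod 5) ℂ) (h₀ : ψ₀.IsPrimitive) :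
    ∃ a : ZMod 5, a ≠ 0 ∧ ψ₀ = AddChar.mulShift TameModel.psi5 a := by
  obtain ⟨a, ha⟩ := DualModel.exists_mulShift_eq TameModel.psi5 TameModel.psi5_isPrimitive ψ₀
  refine ⟨a, ?_, ha⟩
  rintro rfl
  rw [AddChar.mulShift_zero] at ha
  have := h₀ (one_ne_zero : (1 : ZMod 5) ≠ 0)
  rw [ha, AddChar.mulShift_one] at this
  exact this rfl

/-- **The conductor-`3` quadratic Gauss sum for `ψ₀ = ψ₅(a ·)`**: `G(χ_quad, ψ₀(·/2)) = −χ_quad(a) √5`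
(Mathlib `gaussSum_mulShift_eq`, `χ_quad⁻¹ = χ_quad`). -/
theorem gaussSum_quadChar_mulShift_half (a : ZMod 5) (ha : a ≠ 0) :
    gaussSum (quadChar (ZMod 5)) (AddChar.mulShift (AddChar.mulShift TameModel.psi5 a) (2 : ZMod 5)⁻¹) =
      -(TameModel.quadChar5 a * ((Real.sqrt 5 : ℝ) : ℂ)) := by
  have hu : IsUnit a := isUnit_iff_ne_zero.2 ha
  rw [AddChar.mulShift_mulShift, mul_comm, ← AddChar.mulShift_mulShift,
    show a = ((hu.unit : (ZMod 5)ˣ) : ZMod 5) from hu.unit_spec.symm, gaussSum_mulShift_eq, hu.unit_spec,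
    gaussSum_quadChar_psi5_half]
  change TameModel.quadChar5⁻¹ a * _ = _
  rw [TameModel.quadChar5_inv, mul_neg]

/-- `ψ₅(a ·)` is primitive for `a ≠ 0`. -/
theorem mulShift_psi5_isPrimitive (a : ZMod 5) (ha : a ≠ 0) : (AddChar.mulShift TameModel.psi5 a).IsPrimitive := by
  intro b hb
  rw [AddChar.mulShift_mulShift]
  exact TameModel.psi5_isPrimitive (mul_ne_zero ha hb)

/-- **`ε(½, ρ, ψ̃₀) = −χ_quad(a) ρ(ϖ)^n` at conductor `3` for EVERY primitive `ψ₀ = ψ₅(a ·)`** (`κ = (5√5)⁻¹`):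
the sign left open in `OcticCMPointTruncThree.lean` is, for every `ψ₀`, Gauss's sign times the Legendre symbol
of the scaling `a`. -/
theorem eps_twist_three_mulShift (a : ZMod 5) (ha : a ≠ 0) (n : ℕ) (π : ℂ) :
    LocalChar.eps (((5 * Real.sqrt 5)⁻¹ : ℝ) : ℂ) n
      (⟨twist 3 (by norm_num) (by norm_num) (by decide) (by decide) 1 (AddChar.mulShift TameModel.psi5 a), π⟩ :
        LocalChar (Trunc (ZMod 5) 3)) (psiTilde 3 (AddChar.mulShift TameModel.psi5 a)) =
      -(TameModel.quadChar5 a * π ^ n) := by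
  rw [eps_twist_three (by decide) (by decide) _ (mulShift_psi5_isPrimitive a ha), ZMod.card,
    gaussSum_quadChar_mulShift_half a ha]
  have h5 := sqrt_five_ne_zero
  push_cast
  field_simp

/-- **The conductor-`3` root number for every primitive `ψ₀`, in closed form**: there is `a ≠ 0` with
`ψ₀ = ψ₅(a ·)` and `ε(½, ρ, ψ̃₀) = −χ_quad(a) ρ(ϖ)^n`. -/
theorem eps_twist_three_of_isPrimitive (ψ₀ : AddChar (ZMod 5) ℂ) (h₀ : ψ₀.IsPrimitive) (n : ℕ) (π : ℂ) :
    ∃ a : ZMod 5, a ≠ 0 ∧ ψ₀ = AddChar.mulShift TameModel.psi5 a ∧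
      LocalChar.eps (((5 * Real.sqrt 5)⁻¹ : ℝ) : ℂ) n
        (⟨twist 3 (by norm_num) (by norm_num) (by decide) (by decide) 1 ψ₀, π⟩ :
          LocalChar (Trunc (ZMod 5) 3)) (psiTilde 3 ψ₀) = -(TameModel.quadChar5 a * π ^ n) := by
  obtain ⟨a, ha, rfl⟩ := exists_eq_mulShift_psi5 ψ₀ h₀
  exact ⟨a, ha, rfl, eps_twist_three_mulShift a ha n π⟩

/-! ### Conductor `1` at `𝔭 | 5` for every primitive `ψ₀`, the same way -/

/-- **Gauss's sign for every primitive `ψ₀ = ψ₅(a ·)` of `𝔽₅`**: `G(χ_quad, ψ₀) = χ_quad(a) √5`. -/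
theorem gaussSum_quadChar5_mulShift (a : ZMod 5) (ha : a ≠ 0) :
    gaussSum TameModel.quadChar5 (AddChar.mulShift TameModel.psi5 a) = TameModel.quadChar5 a * ((Real.sqrt 5 : ℝ) : ℂ) := by
  have hu : IsUnit a := isUnit_iff_ne_zero.2 ha
  rw [show a = ((hu.unit : (ZMod 5)ˣ) : ZMod 5) from hu.unit_spec.symm, gaussSum_mulShift_eq, hu.unit_spec,
    TameModel.gaussSum_quad_psi5]
  change TameModel.quadChar5⁻¹ a * _ = _
  rw [TameModel.quadChar5_inv]

/-- **The conductor-`1` root number of the quadratic character for every primitive `ψ₀ = ψ₅(a ·)`**: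
`ε(½, ⟨χ_quad, ω(ϖ)⟩, ψ₀) = χ_quad(a) ω(ϖ)^n` (`κ = 5^{−1/2}`) — the `±` of `OcticCMPointTameModel.eps_quad_tame`
is the Legendre symbol of the scaling. -/
theorem eps_quad_mulShift (a : ZMod 5) (ha : a ≠ 0) (n : ℕ) (π : ℂ) :
    LocalChar.eps (((Real.sqrt 5)⁻¹ : ℝ) : ℂ) n (⟨TameModel.quadChar5, π⟩ : LocalChar (ZMod 5))
      (AddChar.mulShift TameModel.psi5 a) = TameModel.quadChar5 a * π ^ n := by
  unfold LocalChar.eps LocalChar.gauss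
  change π ^ n * _ * gaussSum TameModel.quadChar5⁻¹ _ = _
  rw [TameModel.quadChar5_inv, gaussSum_quadChar5_mulShift a ha]
  have h5 := sqrt_five_ne_zero
  push_cast
  field_simp

/-- The same for an arbitrary primitive `ψ₀`: there is `a ≠ 0` with `ψ₀ = ψ₅(a ·)` and
`ε(½, ⟨χ_quad, ω(ϖ)⟩, ψ₀) = χ_quad(a) ω(ϖ)^n`. -/
theorem eps_quad_of_isPrimitive (ψ₀ : AddChar (ZMod 5) ℂ) (h₀ : ψ₀.IsPrimitive) (n : ℕ) (π : ℂ) :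
    ∃ a : ZMod 5, a ≠ 0 ∧ ψ₀ = AddChar.mulShift TameModel.psi5 a ∧
      LocalChar.eps (((Real.sqrt 5)⁻¹ : ℝ) : ℂ) n (⟨TameModel.quadChar5, π⟩ : LocalChar (ZMod 5)) ψ₀ =
        TameModel.quadChar5 a * π ^ n := by
  obtain ⟨a, ha, rfl⟩ := exists_eq_mulShift_psi5 ψ₀ h₀
  exact ⟨a, ha, rfl, eps_quad_mulShift a ha n π⟩

end TruncModel

end Summit.Ventures.HodgeRepro.PeriodCloser

end
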